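import Literature.NumberTheory.Automorphic.DerivWeightSlice
import HarnessLib

/-!
# The archimedean derivative of an archimedean unipotent convolution

Topic `NumberTheory/Automorphic`; namespace `Literature.NumberTheory.Automorphic`. Proof file
(one auxiliary abbreviation `unipotentMatrixGL2`, theorems). For a test function `θ` on `GL_2(𝔸_K)`, a `C^∞` compactly supported real kernel
`g₀` on `K_∞` and `X ∈ 𝔤 = M_2(K_∞)` we PROVE the differentiation-under-the-integral identity of the
commutation calculus (Bump (1997), (2.28)–(2.29); Jacquet–Shalika (1981), §4):

* `leftArchSlice_archUnipotentConv` — the left archimedean slice of the convolution: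
  `leftArchSlice (g₀ ⋆ θ) h (m) = ∫ g₀(x) leftArchSlice θ h (n(-x) m) dx`;
* `leftArchSlice_leftTranslate_archUnipotent` — `leftArchSlice (L_{n(x)} θ) h (m) = leftArchSlice θ h (n(-x) m)`;
* `derivWeight_archUnipotentConv` — **`(g₀ ⋆ θ)_X (h) = ∫ g₀(x) (L_{n((x,0))} θ)_X (h) dx`**
  (`Literature.Analysis.Calculus.hasFDerivAt_integral_kernel_mul` applied to the smooth kernel
  `(m, x) ↦ leftArchSlice θ h (n(-x) m)`, and the slice formula `derivWeight_eq_fderiv_leftArchSlice`).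

## References

* D. Bump, *Automorphic Forms and Representations* (1997), §2.2, (2.28)–(2.29) [Bump1997].
* H. Jacquet, J. A. Shalika, *On Euler products and the classification of automorphic
  representations I*, Amer. J. Math. 103 (1981), §4 [JacquetShalikaAJM1981].
-/

noncomputable section

open scoped MatrixGroups Classical ContDiff
open NumberField NumberField.mixedEmbedding IsDedekindDomain MeasureTheory Complex

namespace Literature.NumberTheory.Automorphic

variable {K : Type} [Field K] [NumberField K]
  (hcpt : isCompact_glFiniteIntegralLevel 2 K)

set_option backward.isDefEq.respectTransparency false

attribute [local instance 100] LieRing.ofAssociativeRing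

/-- `M_2(K_∞)` is finite-dimensional over `ℝ` (local instance). [folklore] -/
private theorem finiteDimensional_matrix_mixedSpace'' : FiniteDimensional ℝ (Matrix (Fin 2) (Fin 2) (mixedSpace K)) :=
  Module.Finite.matrix

attribute [local instance] finiteDimensional_matrix_mixedSpace''

open scoped Matrix.Norms.Operator

/-- The unipotent matrix `N(y) = n(y) ∈ M_2(K_∞)`. [folklore] -/
abbrev unipotentMatrixGL2 (y : mixedSpace K) : Matrix (Fin 2) (Fin 2) (mixedSpace K) :=
  (((unipotentGL2 y : ↥(upperUnitriangular (Fin 2) (mixedSpace K))) : GL (Fin 2) (mixedSpace K)) :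
    Matrix (Fin 2) (Fin 2) (mixedSpace K))

/-- `toMixed (n((x,0))) = n(x)`. [folklore] -/
theorem toMixed_archUnipotentGL (x : mixedSpace K) :
    GLn.toMixed 2 K (archUnipotentGL K x) =
      ((unipotentGL2 x : ↥(upperUnitriangular (Fin 2) (mixedSpace K))) : GL (Fin 2) (mixedSpace K)) := by
  rw [archUnipotentGL_eq, GLn.toMixed_ofInfinite]

/-- **The slice of a unipotent left translate**: `leftArchSlice (L_{n(x)} θ) h (m) = leftArchSlice θ h (n(-x) m)`.
[folklore] -/
theorem leftArchSlice_leftTranslate_archUnipotent (θ : GL (Fin 2) (AdeleRing (𝓞 K) K) → ℝ)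
    (x : mixedSpace K) (h : GL (Fin 2) (AdeleRing (𝓞 K) K)) (m : Matrix (Fin 2) (Fin 2) (mixedSpace K)) :
    leftArchSlice (leftTranslateWeight (n := 2) (archUnipotentGL K x) θ) h m =
      leftArchSlice θ h (unipotentMatrixGL2 (-x) * m) := by
  by_cases hm : IsUnit m
  · obtain ⟨u, rfl⟩ := hm
    have hu : unipotentMatrixGL2 (-x) * (u : Matrix (Fin 2) (Fin 2) (mixedSpace K)) =
        ((((unipotentGL2 (-x) : ↥(upperUnitriangular (Fin 2) (mixedSpace K))) : GL (Fin 2) (mixedSpace K)) * u :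
          GL (Fin 2) (mixedSpace K)) : Matrix (Fin 2) (Fin 2) (mixedSpace K)) := by
      rw [Units.val_mul]
    rw [hu, leftArchSlice_coe, leftArchSlice_coe, leftTranslateWeight_apply, map_mul, ← archUnipotentGL_eq,
      archUnipotentGL_neg, mul_assoc]
  · have hm' : ¬IsUnit (unipotentMatrixGL2 (-x) * m) := by
      intro hu
      apply hm
      have : m = unipotentMatrixGL2 x * (unipotentMatrixGL2 (-x) * m) := by
        rw [← mul_assoc, unipotentMatrixGL2, unipotentMatrixGL2, ← Units.val_mul, ← Subgroup.coe_mul,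
          ← unipotentGL2_add, add_neg_cancel, unipotentGL2_zero, Subgroup.coe_one, Units.val_one, one_mul]
      rw [this]
      exact (Units.isUnit _).mul hu
    rw [leftArchSlice_of_not_isUnit hm, leftArchSlice_of_not_isUnit hm']

/-- **The slice of the convolution**: `leftArchSlice (g₀ ⋆ θ) h (m) = ∫ g₀(x) leftArchSlice θ h (n(-x) m) dx`.
[folklore] -/
theorem leftArchSlice_archUnipotentConv (g₀ : mixedSpace K → ℝ) (θ : GL (Fin 2) (AdeleRing (𝓞 K) K) → ℝ)
    (h : GL (Fin 2) (AdeleRing (𝓞 K) K)) (m : Matrix (Fin 2) (Fin 2) (mixedSpace K)) :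
    leftArchSlice (archUnipotentConv g₀ θ) h m = ∫ x, g₀ x * leftArchSlice θ h (unipotentMatrixGL2 (-x) * m) := by
  by_cases hm : IsUnit m
  · obtain ⟨u, rfl⟩ := hm
    rw [leftArchSlice_coe, archUnipotentConv_apply_gl]
    refine integral_congr_ae (ae_of_all _ fun x => ?_)
    show g₀ x * leftTranslateWeight (n := 2) (archUnipotentGL K x) θ (GLn.ofInfinite 2 K u * h) = _
    rw [← leftArchSlice_coe (η := leftTranslateWeight (n := 2) (archUnipotentGL K x) θ),
      leftArchSlice_leftTranslate_archUnipotent]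
  · rw [leftArchSlice_of_not_isUnit hm]
    symm
    refine integral_eq_zero_of_ae (ae_of_all _ fun x => ?_)
    have hm' : ¬IsUnit (unipotentMatrixGL2 (-x) * m) := by
      intro hu
      apply hm
      have : m = unipotentMatrixGL2 x * (unipotentMatrixGL2 (-x) * m) := by
        rw [← mul_assoc, unipotentMatrixGL2, unipotentMatrixGL2, ← Units.val_mul, ← Subgroup.coe_mul,
          ← unipotentGL2_add, add_neg_cancel, unipotentGL2_zero, Subgroup.coe_one, Units.val_one, one_mul]
      rw [this]
      exact (Units.isUnit _).mul hu
    show g₀ x * leftArchSlice θ h (unipotentMatrixGL2 (-x) * m) = 0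
    rw [leftArchSlice_of_not_isUnit hm', mul_zero]

/-- The joint kernel `(m, x) ↦ leftArchSlice θ h (n(-x) m)` is smooth. [folklore] -/
theorem contDiff_leftArchSlice_unipotent_mul {θ : GL (Fin 2) (AdeleRing (𝓞 K) K) → ℝ}
    (hθ : IsTestFunctionGL 2 K θ) (h : GL (Fin 2) (AdeleRing (𝓞 K) K)) :
    ContDiff ℝ ∞ fun p : Matrix (Fin 2) (Fin 2) (mixedSpace K) × mixedSpace K =>
      leftArchSlice θ h (unipotentMatrixGL2 (-p.2) * p.1) :=
  (hθ.contDiff_leftArchSlice h).comp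
    ((contDiff_coe_unipotentGL2.comp (contDiff_neg.comp contDiff_snd)).mul contDiff_fst)

/-- The partial derivative in `m` of the joint kernel at `(m, x)` is the derivative of the slice of
the translate. [folklore] -/
theorem fderiv_kernel_inl {θ : GL (Fin 2) (AdeleRing (𝓞 K) K) → ℝ} (hθ : IsTestFunctionGL 2 K θ)
    (h : GL (Fin 2) (AdeleRing (𝓞 K) K)) (m : Matrix (Fin 2) (Fin 2) (mixedSpace K)) (x : mixedSpace K)
    (v : Matrix (Fin 2) (Fin 2) (mixedSpace K)) :
    fderiv ℝ (fun p : Matrix (Fin 2) (Fin 2) (mixedSpace K) × mixedSpace K =>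
        leftArchSlice θ h (unipotentMatrixGL2 (-p.2) * p.1)) (m, x) (v, 0) =
      fderiv ℝ (leftArchSlice (leftTranslateWeight (n := 2) (archUnipotentGL K x) θ) h) m v := by
  have hslice : leftArchSlice (leftTranslateWeight (n := 2) (archUnipotentGL K x) θ) h =
      (fun p : Matrix (Fin 2) (Fin 2) (mixedSpace K) × mixedSpace K =>
        leftArchSlice θ h (unipotentMatrixGL2 (-p.2) * p.1)) ∘ fun m' => (m', x) := by
    funext m'
    exact leftArchSlice_leftTranslate_archUnipotent θ x h m'
  have hA := ((contDiff_leftArchSlice_unipotent_mul hθ h).differentiable (by simp)) (m, x)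
  rw [hslice, (hA.hasFDerivAt.comp m (hasFDerivAt_prodMk_left m x)).fderiv]
  rfl

/-- **The derivative of the convolution**: `(g₀ ⋆ θ)_X (h) = ∫ g₀(x) (L_{n((x,0))} θ)_X (h) dx` for a
test function `θ` and a `C^∞` compactly supported kernel `g₀`. [cite: Bump1997, (2.28) (PDF p. 279)] -/
theorem derivWeight_archUnipotentConv {θ : GL (Fin 2) (AdeleRing (𝓞 K) K) → ℝ} (hθ : IsTestFunctionGL 2 K θ)
    {g₀ : mixedSpace K → ℝ} (hg₀ : ContDiff ℝ ∞ g₀) (hg₀s : HasCompactSupport g₀)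
    (X : (AutomorphyDatum.gl 2 K hcpt).arch.lie) (h : (AdelicGroupData.gl 2 K).Adelic) :
    derivWeight (AutomorphyDatum.gl 2 K hcpt).ofArch X (archUnipotentConv g₀ θ) h =
      ∫ x, g₀ x * derivWeight (AutomorphyDatum.gl 2 K hcpt).ofArch X
        (leftTranslateWeight (n := 2) (archUnipotentGL K x) θ) h := by
  -- the smooth complex kernel and the data of `hasFDerivAt_integral_kernel_mul`
  set A : Matrix (Fin 2) (Fin 2) (mixedSpace K) × mixedSpace K → ℂ :=
    fun p => ((leftArchSlice θ h (unipotentMatrixGL2 (-p.2) * p.1) : ℝ) : ℂ) with hA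
  have hAs : ContDiff ℝ ∞ A := Complex.ofRealCLM.contDiff.comp (contDiff_leftArchSlice_unipotent_mul hθ h)
  obtain ⟨R, hR⟩ := (hg₀s.isCompact.isBounded).subset_closedBall (0 : mixedSpace K)
  set ν : Measure (mixedSpace K) := volume.restrict (Metric.closedBall (0 : mixedSpace K) R) with hν
  have hmR : ∀ᵐ x ∂ν, ‖(id x : mixedSpace K)‖ ≤ R := by
    refine (ae_restrict_iff' Metric.isClosed_closedBall.measurableSet).2 (ae_of_all _ fun x hx => ?_)
    simpa only [id, Metric.mem_closedBall, dist_zero_right] using hx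
  have hF : Integrable (fun x => (g₀ x : ℂ)) ν :=
    ((hg₀.continuous.integrable_of_hasCompactSupport hg₀s).ofReal).restrict
  obtain ⟨hint, hderiv⟩ := Literature.Analysis.Calculus.hasFDerivAt_integral_kernel_mul hAs
    aestronglyMeasurable_id hmR hF (1 : Matrix (Fin 2) (Fin 2) (mixedSpace K))
  -- integrals over `ν` are integrals over `K_∞` (the kernel `g₀` vanishes off the ball)
  have hνint : ∀ (G : mixedSpace K → ℝ), ∫ x, g₀ x * G x ∂ν = ∫ x, g₀ x * G x := by
    intro G
    refine setIntegral_eq_integral_of_forall_compl_eq_zero fun x hx => ?_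
    have hx' : x ∉ tsupport g₀ := fun h' => hx (hR h')
    rw [image_eq_zero_of_notMem_tsupport hx', zero_mul]
  -- the real slice of the convolution is the real part of the complex parametric integral
  have hslice : leftArchSlice (archUnipotentConv g₀ θ) h =
      fun m => Complex.re (∫ x, A (m, id x) * (g₀ x : ℂ) ∂ν) := by
    funext m
    have h1 : ∫ x, A (m, id x) * (g₀ x : ℂ) ∂ν =
        ((∫ x, g₀ x * leftArchSlice θ h (unipotentMatrixGL2 (-x) * m) ∂ν : ℝ) : ℂ) := by
      rw [← integral_complex_ofReal]
      refine integral_congr_ae (ae_of_all _ fun x => ?_)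
      simp only [hA, id, Complex.ofReal_mul, mul_comm]
    rw [h1, Complex.ofReal_re, hνint, leftArchSlice_archUnipotentConv]
  -- differentiate
  rw [derivWeight_eq_fderiv_leftArchSlice hcpt (isTestFunctionGL_archUnipotentConv hθ hg₀ hg₀s), hslice]
  have hre : HasFDerivAt (fun m => Complex.re (∫ x, A (m, id x) * (g₀ x : ℂ) ∂ν))
      (Complex.reCLM.comp (∫ x, (g₀ x : ℂ) • (fderiv ℝ A (1, id x)).comp
        (ContinuousLinearMap.inl ℝ (Matrix (Fin 2) (Fin 2) (mixedSpace K)) (mixedSpace K)) ∂ν)) 1 :=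
    Complex.reCLM.hasFDerivAt.comp 1 hderiv
  rw [hre.fderiv, ContinuousLinearMap.coe_comp, Function.comp_apply, ContinuousLinearMap.integral_apply hint]
  -- evaluate the integrand at `-X`
  have hpt : ∀ x : mixedSpace K,
      ((g₀ x : ℂ) • (fderiv ℝ A (1, id x)).comp
        (ContinuousLinearMap.inl ℝ (Matrix (Fin 2) (Fin 2) (mixedSpace K)) (mixedSpace K)))
          (-(X : Matrix (Fin 2) (Fin 2) (mixedSpace K))) =
        ((g₀ x * derivWeight (AutomorphyDatum.gl 2 K hcpt).ofArch X
          (leftTranslateWeight (n := 2) (archUnipotentGL K x) θ) h : ℝ) : ℂ) := by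
    intro x
    have hAeq : A = Complex.ofRealCLM ∘ (fun p : Matrix (Fin 2) (Fin 2) (mixedSpace K) × mixedSpace K =>
        leftArchSlice θ h (unipotentMatrixGL2 (-p.2) * p.1)) := by
      funext p; rfl
    have hdA : fderiv ℝ A (1, x) (-(X : Matrix (Fin 2) (Fin 2) (mixedSpace K)), 0) =
        ((fderiv ℝ (fun p : Matrix (Fin 2) (Fin 2) (mixedSpace K) × mixedSpace K =>
          leftArchSlice θ h (unipotentMatrixGL2 (-p.2) * p.1)) (1, x)
            (-(X : Matrix (Fin 2) (Fin 2) (mixedSpace K)), 0) : ℝ) : ℂ) := by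
      rw [hAeq, (Complex.ofRealCLM.hasFDerivAt.comp (1, x)
        (((contDiff_leftArchSlice_unipotent_mul hθ h).differentiable (by simp)) (1, x)).hasFDerivAt).fderiv]
      rfl
    simp only [FunLike.coe_smul, Pi.smul_apply, ContinuousLinearMap.coe_comp, Function.comp_apply,
      ContinuousLinearMap.inl_apply, id, smul_eq_mul, Complex.ofReal_mul]
    rw [hdA, fderiv_kernel_inl hθ h 1 x, ← derivWeight_eq_fderiv_leftArchSlice hcpt (hθ.leftTranslate _)]
  simp_rw [hpt]
  rw [integral_complex_ofReal, Complex.reCLM_apply, Complex.ofReal_re, hνint]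

end Literature.NumberTheory.Automorphic
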